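import Summits.NavierStokesRegularity.NavierStokesRegularity.Theorems.HodographBetchovSlowClassProductionStubFarFieldVelocity
import Summits.NavierStokesRegularity.NavierStokesRegularity.Theorems.HodographBetchovFastClassSqueezeOfBounded
import Summits.NavierStokesRegularity.NavierStokesRegularity.Theorems.HodographBetchovFastClassSqueezeNoConcentration
import Literature.Analysis.FluidPDE.LocalTypeI

/-!
# `FastClassSqueeze` (stmt-NavierStokesRegularity-15832) localises to germs at the top singular set

Route `HodographBetchov`, crux 3 (an a-priori Miller middle-eigenvalue bound on the fast class
`{|u(t)| > l}` of every classical Leray–Hopf flow on `[0,T)`).  Only the germ of the flow at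
`{T} × Σ_T(u)` matters, `Σ_T(u) = {x | (T, x) is a backward singular point of u}`
(`IsBackwardSingularPoint`: `u` essentially unbounded on every `Q_r(T,x) = (T − r², T) × B_r(x)`;
Albritton–Barker 2019 §1) — the localisation asked for by the card `Ideas/resolved-weyl-split.md`:
* §1 `Σ_T(u)` is closed and, by the far-field bound up to the final time
  (`SlowClassProduction.NearField.stub_farFieldVelocity`, Rusin–Šverák 2011 §4), bounded: COMPACT;
* §2 for every open `U ⊇ Σ_T(u)` the velocity is bounded on `[0,T) × Uᶜ` (finite subcover by regular
  cylinders + far field + Tao persistence on the early closed slab), so the fast class lies in `U`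
  for all `t < T` once `l` is large (`exists_fastClass_subset`);
* §3 transfers: the crux's conclusion holds for a flow with no top singular point, and in general
  follows from squeeze data given only on `(τ,T) × U` (`fastClassSqueeze_of_germSqueeze`).
The companion file `…TopSingularNull.lean` adds `μH[1] (Σ_T(u)) = 0` (CKN Theorem B at the top slice).

References: Albritton–Barker, J. Math. Fluid Mech. 21 (2019) §1 [AlbrittonBarker2019]; Rusin–Šverák,
J. Funct. Anal. 260 (2011) §4 [RusinSverak2011]; Tao, Anal. PDE 6 (2013) Cor. 11.1 [Tao2011].
-/

noncomputable section

-- the summit and its single problem share the name `NavierStokesRegularity` (D-0017 nested layout)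
set_option linter.dupNamespace false

namespace Summit.NavierStokesRegularity.NavierStokesRegularity.Theorems.FastClassSqueeze.Germ

open Set MeasureTheory Function Metric Filter Topology Literature.Analysis.FluidPDE
open scoped ENNReal NNReal

/-! ### §1 Topology of the top singular set -/

/-- A point is NOT a backward singular point iff `u` is essentially bounded on some backward
parabolic cylinder with that vertex. [folklore] -/
theorem not_isBackwardSingularPoint_iff
    {u : ℝ → EuclideanSpace ℝ (Fin 3) → EuclideanSpace ℝ (Fin 3)}
    {z : ℝ × EuclideanSpace ℝ (Fin 3)} :
    ¬ IsBackwardSingularPoint u z ↔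
      ∃ r : ℝ, 0 < r ∧ eLpNorm (uncurry u) ∞ (volume.restrict (parabolicCylinder r z)) < ∞ := by
  simp only [IsBackwardSingularPoint, not_forall, exists_prop, lt_top_iff_ne_top]

/-- Half-size backward cylinders at points of `B(x, r/2)` lie in the cylinder `Q_r(T, x)`.
[folklore] -/
theorem parabolicCylinder_half_subset {T r : ℝ} {x y : EuclideanSpace ℝ (Fin 3)}
    (hy : y ∈ ball x (r / 2)) :
    parabolicCylinder (r / 2) ((T : ℝ), y) ⊆ parabolicCylinder r ((T : ℝ), x) := by
  intro w hw
  rw [mem_parabolicCylinder] at hw ⊢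
  refine ⟨⟨?_, hw.1.2⟩, ?_⟩
  · have h1 : (T : ℝ) - (r / 2) ^ 2 < w.1 := hw.1.1
    nlinarith [sq_nonneg r]
  · calc dist w.2 x ≤ dist w.2 y + dist y x := dist_triangle _ _ _
      _ < r := by linarith [hw.2, mem_ball.1 hy]

/-- The set of top-slice points that are NOT backward singular is open. [folklore] -/
theorem isOpen_setOf_not_isBackwardSingularPoint
    (u : ℝ → EuclideanSpace ℝ (Fin 3) → EuclideanSpace ℝ (Fin 3)) (T : ℝ) :
    IsOpen {x : EuclideanSpace ℝ (Fin 3) | ¬ IsBackwardSingularPoint u (T, x)} := by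
  rw [Metric.isOpen_iff]
  intro x hx
  obtain ⟨r, hr, hfin⟩ := not_isBackwardSingularPoint_iff.1 hx
  refine ⟨r / 2, by positivity, fun y hy => ?_⟩
  refine not_isBackwardSingularPoint_iff.2 ⟨r / 2, by positivity, lt_of_le_of_lt ?_ hfin⟩
  exact eLpNorm_mono_measure _ (Measure.restrict_mono (parabolicCylinder_half_subset hy) le_rfl)

/-- **The top singular set `Σ_T(u) = {x | (T,x) is a backward singular point}` is closed.**
[folklore] -/
theorem isClosed_topSingularSet
    (u : ℝ → EuclideanSpace ℝ (Fin 3) → EuclideanSpace ℝ (Fin 3)) (T : ℝ) :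
    IsClosed {x : EuclideanSpace ℝ (Fin 3) | IsBackwardSingularPoint u (T, x)} := by
  rw [← isOpen_compl_iff, compl_setOf]
  exact isOpen_setOf_not_isBackwardSingularPoint u T

/-- A pointwise bound on a measurable space–time set gives a finite `L^∞` norm there. [folklore] -/
theorem eLpNorm_top_lt_top_of_forall_le
    {u : ℝ → EuclideanSpace ℝ (Fin 3) → EuclideanSpace ℝ (Fin 3)}
    {S : Set (ℝ × EuclideanSpace ℝ (Fin 3))} (hS : MeasurableSet S) {L : ℝ}
    (h : ∀ z ∈ S, ‖uncurry u z‖ ≤ L) :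
    eLpNorm (uncurry u) ∞ (volume.restrict S) < ∞ := by
  rw [eLpNorm_exponent_top]
  exact eLpNormEssSup_lt_top_of_ae_bound (C := L) ((ae_restrict_iff' hS).2 (Eventually.of_forall h))

/-- **Regular points: a pointwise bound on a one-sided neighbourhood.**  For a classical solution on
`ℝ³ × [0,T)`, if `(T, x)` is not a backward singular point then `u` is bounded (pointwise, by joint
continuity) on `(max (T − r²) 0, T) × B(x, r)` for some `r > 0`. [folklore] -/
theorem exists_forall_norm_le_of_not_isBackwardSingularPoint {ν T : ℝ}
    {u : ℝ → EuclideanSpace ℝ (Fin 3) → EuclideanSpace ℝ (Fin 3)}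
    {p : ℝ → EuclideanSpace ℝ (Fin 3) → ℝ}
    (hcl : IsClassicalNSSolutionOn (Ico 0 T) ν 0 u p) {x : EuclideanSpace ℝ (Fin 3)}
    (hx : ¬ IsBackwardSingularPoint u (T, x)) :
    ∃ r : ℝ, 0 < r ∧ ∃ M : ℝ, ∀ s ∈ Ioo (max (T - r ^ 2) 0) T, ∀ y ∈ ball x r, ‖u s y‖ ≤ M := by
  obtain ⟨r, hr, hfin⟩ := not_isBackwardSingularPoint_iff.1 hx
  set Q : Set (ℝ × EuclideanSpace ℝ (Fin 3)) := parabolicCylinder r ((T : ℝ), x) with hQ_def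
  set M : ℝ := (eLpNorm (uncurry u) ∞ (volume.restrict Q)).toReal with hM_def
  have hMeq : eLpNorm (uncurry u) ∞ (volume.restrict Q) = ENNReal.ofReal M := by
    rw [hM_def, ENNReal.ofReal_toReal hfin.ne]
  have hae : ∀ᵐ z ∂(volume.restrict Q), ‖uncurry u z‖ ≤ M := by
    have h1 : ∀ᵐ z ∂(volume.restrict Q), ‖uncurry u z‖ₑ ≤ ENNReal.ofReal M := by
      refine (ae_le_eLpNormEssSup (f := uncurry u)).mono fun z hz => hz.trans ?_
      rw [← eLpNorm_exponent_top, hMeq]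
    filter_upwards [h1] with z hz
    rw [← ofReal_norm] at hz
    exact (ENNReal.ofReal_le_ofReal_iff ENNReal.toReal_nonneg).1 hz
  -- the open one-sided neighbourhood inside `[0,T) × ℝ³`
  set O : Set (ℝ × EuclideanSpace ℝ (Fin 3)) := Ioo (max (T - r ^ 2) 0) T ×ˢ ball x r with hO_def
  have hO : IsOpen O := isOpen_Ioo.prod isOpen_ball
  have hOQ : O ⊆ Q := by
    intro w hw
    rw [hQ_def, mem_parabolicCylinder]
    exact ⟨⟨(le_max_left _ _).trans_lt hw.1.1, hw.1.2⟩, mem_ball.1 hw.2⟩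
  have hOslab : O ⊆ Ico 0 T ×ˢ (univ : Set (EuclideanSpace ℝ (Fin 3))) :=
    prod_mono (fun s hs => ⟨((le_max_right _ _).trans_lt hs.1).le, hs.2⟩) (subset_univ _)
  have hcont : ContinuousOn (fun z : ℝ × EuclideanSpace ℝ (Fin 3) => ‖uncurry u z‖) O :=
    (hcl.smooth_velocity.continuousOn.mono hOslab).norm
  have hptw : ∀ z ∈ O, ‖uncurry u z‖ ≤ M :=
    SlowClassProduction.Birth.forall_le_of_ae_restrict_le hO hcont
      (ae_restrict_of_ae_restrict_of_subset hOQ hae)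
  exact ⟨r, hr, M, fun s hs y hy => hptw (s, y) (mk_mem_prod hs hy)⟩

/-- **Far points are regular.**  For the flows of the crux (classical on `[0,T)`, Leray–Hopf from a
rapidly decaying datum) the top singular set lies in a closed ball: beyond the far-field radius of
`stub_farFieldVelocity` the velocity is bounded up to the final time. [cite: RusinSverak2011, §4 p. 6] -/
theorem topSingularSet_subset_closedBall {ν T : ℝ} (hν : 0 < ν) (hT : 0 < T)
    {u : ℝ → EuclideanSpace ℝ (Fin 3) → EuclideanSpace ℝ (Fin 3)}
    {p : ℝ → EuclideanSpace ℝ (Fin 3) → ℝ}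
    (hcl : IsClassicalNSSolutionOn (Ico 0 T) ν 0 u p) (hLH : IsLerayHopfOn T ν 0 (u 0) u)
    (hdec : HasRapidSpatialDecay (u 0)) :
    ∃ R : ℝ, {x : EuclideanSpace ℝ (Fin 3) | IsBackwardSingularPoint u (T, x)} ⊆ closedBall 0 R := by
  obtain ⟨h, hh, -, R, L, hfar⟩ :=
    SlowClassProduction.NearField.stub_farFieldVelocity ν T hν hT u p hcl hLH hdec
  refine ⟨R + 1, fun x hx => ?_⟩
  by_contra hxR
  rw [mem_closedBall, dist_zero_right, not_le] at hxR
  -- the cylinder `Q_ρ(T, x)`, `ρ = min 1 h`, lies in the far-field final layer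
  set ρ : ℝ := min 1 h with hρ_def
  have hρ0 : 0 < ρ := lt_min one_pos hh
  have hρ1 : ρ ≤ 1 := min_le_left _ _
  have hρh : ρ ≤ h := min_le_right _ _
  have hρsq : ρ ^ 2 ≤ h := by nlinarith
  have hbd : ∀ z ∈ parabolicCylinder ρ ((T : ℝ), x), ‖uncurry u z‖ ≤ L := by
    intro z hz
    rw [mem_parabolicCylinder] at hz
    refine hfar z.1 ⟨by linarith [hz.1.1], hz.1.2⟩ z.2 ?_
    have h1 : ‖x‖ ≤ ‖z.2‖ + dist z.2 x := by
      have := norm_sub_norm_le x z.2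
      rw [dist_eq_norm, ← norm_sub_rev x z.2]
      linarith
    linarith [hz.2]
  exact (not_isBackwardSingularPoint_iff.2 ⟨ρ, hρ0,
    eLpNorm_top_lt_top_of_forall_le (isOpen_parabolicCylinder ρ _).measurableSet hbd⟩) hx

/-- **The top singular set of a flow of the crux is compact** (closed, and bounded by the far-field
bound). [cite: RusinSverak2011, §4 p. 6] -/
theorem isCompact_topSingularSet {ν T : ℝ} (hν : 0 < ν) (hT : 0 < T)
    {u : ℝ → EuclideanSpace ℝ (Fin 3) → EuclideanSpace ℝ (Fin 3)}
    {p : ℝ → EuclideanSpace ℝ (Fin 3) → ℝ}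
    (hcl : IsClassicalNSSolutionOn (Ico 0 T) ν 0 u p) (hLH : IsLerayHopfOn T ν 0 (u 0) u)
    (hdec : HasRapidSpatialDecay (u 0)) :
    IsCompact {x : EuclideanSpace ℝ (Fin 3) | IsBackwardSingularPoint u (T, x)} := by
  obtain ⟨R, hR⟩ := topSingularSet_subset_closedBall hν hT hcl hLH hdec
  exact Metric.isCompact_of_isClosed_isBounded (isClosed_topSingularSet u T)
    (isBounded_closedBall.subset hR)

/-! ### §2 The velocity is bounded off any neighbourhood of the top singular set -/

/-- **Boundedness off a neighbourhood of the top singular set.**  For `ν, T > 0`, a classical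
solution `(u, p)` of unforced Navier–Stokes on `ℝ³ × [0,T)`, Leray–Hopf from its rapidly decaying
datum, and an open `U ⊇ Σ_T(u)`, the velocity is bounded on `[0,T) × Uᶜ`: the compact set
`B̄(0, R+1) ∖ U` of regular top points is covered by finitely many regular cylinders (pointwise
bounds `exists_forall_norm_le_of_not_isBackwardSingularPoint`), the far field `{‖x‖ > R+1}` is
bounded on the final layer (`stub_farFieldVelocity`), and the early closed slab `[0, T − δ/2] × ℝ³`
is bounded by Tao's persistence of regularity (`Birth.exists_forall_norm_le_on_closedSlab`).
[cite: RusinSverak2011, §4 p. 6] [cite: Tao2011, Cor. 11.1 + Cor. 4.3 + Thm. 5.4 (iv)] -/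
theorem exists_forall_norm_le_off_nhds {ν T : ℝ} (hν : 0 < ν) (hT : 0 < T)
    {u : ℝ → EuclideanSpace ℝ (Fin 3) → EuclideanSpace ℝ (Fin 3)}
    {p : ℝ → EuclideanSpace ℝ (Fin 3) → ℝ}
    (hcl : IsClassicalNSSolutionOn (Ico 0 T) ν 0 u p) (hLH : IsLerayHopfOn T ν 0 (u 0) u)
    (hdec : HasRapidSpatialDecay (u 0)) {U : Set (EuclideanSpace ℝ (Fin 3))} (hU : IsOpen U)
    (hSU : {x : EuclideanSpace ℝ (Fin 3) | IsBackwardSingularPoint u (T, x)} ⊆ U) :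
    ∃ L : ℝ, ∀ t ∈ Ico 0 T, ∀ x, x ∉ U → ‖u t x‖ ≤ L := by
  obtain ⟨h, hh, hhT, R, Lfar, hfar⟩ :=
    SlowClassProduction.NearField.stub_farFieldVelocity ν T hν hT u p hcl hLH hdec
  -- the compact set `K = B̄(0, R+1) ∖ U` consists of regular top points
  set K : Set (EuclideanSpace ℝ (Fin 3)) := closedBall 0 (R + 1) \ U with hK_def
  have hKc : IsCompact K := (isCompact_closedBall _ _).diff hU
  have hreg : ∀ x ∈ K, ∃ r : ℝ, 0 < r ∧ ∃ M : ℝ,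
      ∀ s ∈ Ioo (max (T - r ^ 2) 0) T, ∀ y ∈ ball x r, ‖u s y‖ ≤ M := fun x hx =>
    exists_forall_norm_le_of_not_isBackwardSingularPoint hcl fun hsing => hx.2 (hSU hsing)
  choose! r hr M hM using hreg
  obtain ⟨F, hFK, hKF⟩ := hKc.elim_nhds_subcover (fun x => ball x (r x))
    (fun x hx => ball_mem_nhds x (hr x hx))
  -- a common time window `δ ≤ h`, `δ ≤ r(y)²` for `y ∈ F`, and a common bound `M₂` on `F`
  obtain ⟨δ, hδ0, hδh, hδr⟩ : ∃ δ : ℝ, 0 < δ ∧ δ ≤ h ∧ ∀ y ∈ F, δ ≤ r y ^ 2 := by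
    rcases F.eq_empty_or_nonempty with hF | hF
    · exact ⟨h, hh, le_rfl, fun y hy => by simp [hF] at hy⟩
    · refine ⟨min h (F.inf' hF fun y => r y ^ 2), lt_min hh ?_, min_le_left _ _, fun y hy =>
        (min_le_right _ _).trans (F.inf'_le _ hy)⟩
      rw [Finset.lt_inf'_iff]
      exact fun y hy => pow_pos (hr y (hFK y hy)) 2
  set M₂ : ℝ := ∑ y ∈ F, |M y| with hM₂_def
  have hM₂ : ∀ y ∈ F, M y ≤ M₂ := fun y hy =>
    (le_abs_self (M y)).trans (Finset.single_le_sum (fun z _ => abs_nonneg (M z)) hy)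
  -- the early closed slab `[0, T - δ/2]`
  have hτ0 : 0 < T - δ / 2 := by linarith
  have hτT : T - δ / 2 < T := by linarith
  obtain ⟨M₁, hM₁⟩ := Birth.exists_forall_norm_le_on_closedSlab hν hcl hLH hdec hτ0 hτT
  refine ⟨max M₁ (max M₂ Lfar), fun t ht x hxU => ?_⟩
  rcases le_or_gt t (T - δ / 2) with hearly | hlate
  · exact (hM₁ t ⟨ht.1, hearly⟩ x).trans (le_max_left _ _)
  · rcases le_or_gt ‖x‖ (R + 1) with hnear | hfarx
    · -- `x ∈ K` lies in a regular cylinder of the finite cover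
      have hxK : x ∈ K := ⟨mem_closedBall_zero_iff.2 hnear, hxU⟩
      obtain ⟨y, hyF, hxy⟩ := mem_iUnion₂.1 (hKF hxK)
      have hs : t ∈ Ioo (max (T - r y ^ 2) 0) T :=
        ⟨max_lt (by linarith [hδr y hyF]) (by linarith), ht.2⟩
      exact ((hM y (hFK y hyF) t hs x hxy).trans (hM₂ y hyF)).trans
        ((le_max_left _ _).trans (le_max_right _ _))
    · -- far field on the final layer
      exact (hfar t ⟨by linarith, ht.2⟩ x (by linarith)).trans
        ((le_max_right _ _).trans (le_max_right _ _))

/-- **The fast class shrinks onto the top singular set.**  Under the hypotheses of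
`exists_forall_norm_le_off_nhds`, for every open `U ⊇ Σ_T(u)` there is a level `l₀` such that the
fast class `{x | l < ‖u(t,x)‖}` lies in `U` for every `l ≥ l₀` and every `t ∈ [0,T)`.
[cite: RusinSverak2011, §4 p. 6] -/
theorem exists_fastClass_subset {ν T : ℝ} (hν : 0 < ν) (hT : 0 < T)
    {u : ℝ → EuclideanSpace ℝ (Fin 3) → EuclideanSpace ℝ (Fin 3)}
    {p : ℝ → EuclideanSpace ℝ (Fin 3) → ℝ}
    (hcl : IsClassicalNSSolutionOn (Ico 0 T) ν 0 u p) (hLH : IsLerayHopfOn T ν 0 (u 0) u)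
    (hdec : HasRapidSpatialDecay (u 0)) {U : Set (EuclideanSpace ℝ (Fin 3))} (hU : IsOpen U)
    (hSU : {x : EuclideanSpace ℝ (Fin 3) | IsBackwardSingularPoint u (T, x)} ⊆ U) :
    ∃ l₀ : ℝ, ∀ l : ℝ, l₀ ≤ l → ∀ t ∈ Ico 0 T,
      {x : EuclideanSpace ℝ (Fin 3) | l < ‖u t x‖} ⊆ U := by
  obtain ⟨L, hL⟩ := exists_forall_norm_le_off_nhds hν hT hcl hLH hdec hU hSU
  refine ⟨L, fun l hl t ht x hx => ?_⟩
  by_contra hxU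
  exact absurd ((hL t ht x hxU).trans hl) (not_le.2 hx)

/-! ### §3 Transfers to the crux -/

/-- **The crux's conclusion for a flow with no top singular point.**  If no `(T, x)` is a backward
singular point, the velocity is bounded on `[0,T) × ℝ³` (`exists_forall_norm_le_off_nhds` with
`U = ∅`), so the fast class of a large level is empty and the conclusion of `FastClassSqueeze` holds
trivially (`conclusion_of_bounded`). [cite: RusinSverak2011, §4 p. 6] -/
theorem conclusion_of_forall_not_isBackwardSingularPoint {ν T : ℝ} (hν : 0 < ν) (hT : 0 < T)
    {u : ℝ → EuclideanSpace ℝ (Fin 3) → EuclideanSpace ℝ (Fin 3)}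
    {p : ℝ → EuclideanSpace ℝ (Fin 3) → ℝ}
    (hcl : IsClassicalNSSolutionOn (Ico 0 T) ν 0 u p) (hLH : IsLerayHopfOn T ν 0 (u 0) u)
    (hdec : HasRapidSpatialDecay (u 0))
    (hreg : ∀ x : EuclideanSpace ℝ (Fin 3), ¬ IsBackwardSingularPoint u (T, x)) :
    ∃ l : ℝ, 0 < l ∧ ∃ q : ℝ, 3 / 2 < q ∧ ∃ m : ℝ → EuclideanSpace ℝ (Fin 3) → ℝ,
      (∀ t x, 0 ≤ m t x) ∧
      (∀ t ∈ Set.Ico 0 T, ∀ x, l < ‖u t x‖ → ∃ v w : EuclideanSpace ℝ (Fin 3),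
        ‖v‖ = 1 ∧ ‖w‖ = 1 ∧ inner ℝ v w = 0 ∧
        ∀ α β : ℝ, inner ℝ (fderiv ℝ (u t) x (α • v + β • w)) (α • v + β • w) ≤
          m t x * (α ^ 2 + β ^ 2)) ∧
      ∫⁻ t in Set.Ioo 0 T, (∫⁻ x in {x : EuclideanSpace ℝ (Fin 3) | l < ‖u t x‖},
        ENNReal.ofReal (m t x) ^ q) ^ (2 / (2 * q - 3)) < ⊤ := by
  obtain ⟨L, hL⟩ := exists_forall_norm_le_off_nhds hν hT hcl hLH hdec isOpen_empty
    (fun x hx => (hreg x hx).elim)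
  exact conclusion_of_bounded T u L fun t ht x => hL t ht x (Set.notMem_empty x)

/-- **The crux's conclusion from GERM squeeze data.**  Let `(u, p)` be a flow of the crux on `[0,T)`,
`U ⊇ Σ_T(u)` open and `τ < T`.  Suppose the min–max middle-strain majorant `m ≥ 0` is given only at
fast points `(t, x)` with `τ < t < T`, `x ∈ U`, `l < ‖u(t,x)‖`, with the Miller bound
`∫_τ^T (∫_{{l<|u(t)|} ∩ U} m^q)^{2/(2q−3)} dt < ∞`, `q > 3/2`.  Then the conclusion of
`FastClassSqueeze` holds for `u`: raising the level above the bounds of `u` off `U`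
(`exists_forall_norm_le_off_nhds`) and on `[0, max τ (T/2)] × ℝ³`
(`Birth.exists_forall_norm_le_on_closedSlab`) puts the whole fast class inside `(τ,T) × U`, where the
data apply, and the Miller integral over `(0,T)` is at most the germ integral.
[cite: Tao2011, Cor. 11.1 + Cor. 4.3 + Thm. 5.4 (iv)] -/
theorem conclusion_of_germSqueeze {ν T : ℝ} (hν : 0 < ν) (hT : 0 < T)
    {u : ℝ → EuclideanSpace ℝ (Fin 3) → EuclideanSpace ℝ (Fin 3)}
    {p : ℝ → EuclideanSpace ℝ (Fin 3) → ℝ}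
    (hcl : IsClassicalNSSolutionOn (Ico 0 T) ν 0 u p) (hLH : IsLerayHopfOn T ν 0 (u 0) u)
    (hdec : HasRapidSpatialDecay (u 0)) {U : Set (EuclideanSpace ℝ (Fin 3))} (hU : IsOpen U)
    (hSU : {x : EuclideanSpace ℝ (Fin 3) | IsBackwardSingularPoint u (T, x)} ⊆ U)
    {τ l q : ℝ} (hτT : τ < T) (hq : 3 / 2 < q) {m : ℝ → EuclideanSpace ℝ (Fin 3) → ℝ}
    (hm0 : ∀ t x, 0 ≤ m t x)
    (hclause : ∀ t ∈ Ico 0 T, τ < t → ∀ x ∈ U, l < ‖u t x‖ → ∃ v w : EuclideanSpace ℝ (Fin 3),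
      ‖v‖ = 1 ∧ ‖w‖ = 1 ∧ inner ℝ v w = 0 ∧
      ∀ α β : ℝ, inner ℝ (fderiv ℝ (u t) x (α • v + β • w)) (α • v + β • w) ≤
        m t x * (α ^ 2 + β ^ 2))
    (hint : ∫⁻ t in Ioo τ T, (∫⁻ x in {x : EuclideanSpace ℝ (Fin 3) | l < ‖u t x‖} ∩ U,
      ENNReal.ofReal (m t x) ^ q) ^ (2 / (2 * q - 3)) < ⊤) :
    ∃ l : ℝ, 0 < l ∧ ∃ q : ℝ, 3 / 2 < q ∧ ∃ m : ℝ → EuclideanSpace ℝ (Fin 3) → ℝ,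
      (∀ t x, 0 ≤ m t x) ∧
      (∀ t ∈ Set.Ico 0 T, ∀ x, l < ‖u t x‖ → ∃ v w : EuclideanSpace ℝ (Fin 3),
        ‖v‖ = 1 ∧ ‖w‖ = 1 ∧ inner ℝ v w = 0 ∧
        ∀ α β : ℝ, inner ℝ (fderiv ℝ (u t) x (α • v + β • w)) (α • v + β • w) ≤
          m t x * (α ^ 2 + β ^ 2)) ∧
      ∫⁻ t in Set.Ioo 0 T, (∫⁻ x in {x : EuclideanSpace ℝ (Fin 3) | l < ‖u t x‖},
        ENNReal.ofReal (m t x) ^ q) ^ (2 / (2 * q - 3)) < ⊤ := by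
  -- bounds off `U` and on the early slab `[0, τ']`, `τ' = max τ (T/2)`
  obtain ⟨L₁, hL₁⟩ := exists_forall_norm_le_off_nhds hν hT hcl hLH hdec hU hSU
  set τ' : ℝ := max τ (T / 2) with hτ'_def
  have hτ'0 : 0 < τ' := lt_max_of_lt_right (by positivity)
  have hτ'T : τ' < T := max_lt hτT (by linarith)
  obtain ⟨L₂, hL₂⟩ := Birth.exists_forall_norm_le_on_closedSlab hν hcl hLH hdec hτ'0 hτ'T
  set l' : ℝ := |l| + |L₁| + |L₂| + 1 with hl'_def
  have hl'pos : 0 < l' := by positivity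
  have hll' : l < l' := by
    have := le_abs_self l; have := abs_nonneg L₁; have := abs_nonneg L₂; linarith
  have hL₁l' : L₁ < l' := by
    have := le_abs_self L₁; have := abs_nonneg l; have := abs_nonneg L₂; linarith
  have hL₂l' : L₂ < l' := by
    have := le_abs_self L₂; have := abs_nonneg l; have := abs_nonneg L₁; linarith
  -- fast points of level `l'` lie in `U`, occur only after `τ`, and are fast of level `l`
  have hfastU : ∀ t ∈ Ico 0 T, ∀ x, l' < ‖u t x‖ → x ∈ U := by
    intro t ht x hx
    by_contra hxU
    exact absurd ((hL₁ t ht x hxU).trans hL₁l'.le) (not_le.2 hx)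
  have hfastτ : ∀ t ∈ Ico 0 T, ∀ x, l' < ‖u t x‖ → τ < t := by
    intro t ht x hx
    by_contra hτt
    have h1 : t ∈ Icc 0 τ' := ⟨ht.1, (not_lt.1 hτt).trans (le_max_left _ _)⟩
    exact absurd ((hL₂ t h1 x).trans hL₂l'.le) (not_le.2 hx)
  refine ⟨l', hl'pos, q, hq, m, hm0, fun t ht x hx =>
    hclause t ht (hfastτ t ht x hx) x (hfastU t ht x hx) (hll'.trans hx), ?_⟩
  -- the Miller integral over `(0,T)` is at most the germ integral over `(τ,T)`
  set e : ℝ := 2 / (2 * q - 3) with he_def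
  have he : 0 < e := div_pos two_pos (by linarith)
  set g : ℝ → ℝ≥0∞ := fun t => (∫⁻ x in {x : EuclideanSpace ℝ (Fin 3) | l < ‖u t x‖} ∩ U,
    ENNReal.ofReal (m t x) ^ q) ^ e with hg_def
  have hpt : ∀ t ∈ Ioo 0 T, (∫⁻ x in {x : EuclideanSpace ℝ (Fin 3) | l' < ‖u t x‖},
      ENNReal.ofReal (m t x) ^ q) ^ e ≤ (Ioi τ).indicator g t := by
    intro t ht
    have ht' : t ∈ Ico 0 T := ⟨ht.1.le, ht.2⟩
    by_cases hτt : τ < t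
    · rw [indicator_of_mem (mem_Ioi.2 hτt), hg_def]
      exact ENNReal.rpow_le_rpow (lintegral_mono_set fun x hx =>
        ⟨hll'.trans hx, hfastU t ht' x hx⟩) he.le
    · have hempty : {x : EuclideanSpace ℝ (Fin 3) | l' < ‖u t x‖} = ∅ :=
        eq_empty_of_forall_notMem fun x hx => hτt (hfastτ t ht' x hx)
      rw [hempty, Measure.restrict_empty, lintegral_zero_measure, ENNReal.zero_rpow_of_pos he]
      exact zero_le
  calc ∫⁻ t in Ioo 0 T, (∫⁻ x in {x : EuclideanSpace ℝ (Fin 3) | l' < ‖u t x‖},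
        ENNReal.ofReal (m t x) ^ q) ^ e
      ≤ ∫⁻ t in Ioo 0 T, (Ioi τ).indicator g t := setLIntegral_mono' measurableSet_Ioo hpt
    _ = ∫⁻ t in Ioi τ ∩ Ioo 0 T, g t := by
        rw [lintegral_indicator measurableSet_Ioi, Measure.restrict_restrict measurableSet_Ioi]
    _ ≤ ∫⁻ t in Ioo τ T, g t := lintegral_mono_set fun t ht => ⟨ht.1, ht.2.2⟩
    _ < ⊤ := hint

/-- **`FastClassSqueeze` from no top singular points.**  If no flow of the crux has a backward
singular point on its final slice `{t = T}`, then `FastClassSqueeze` holds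
(`conclusion_of_forall_not_isBackwardSingularPoint`). [cite: RusinSverak2011, §4 p. 6] -/
theorem fastClassSqueeze_of_forall_not_isBackwardSingularPoint :
    (∀ (ν T : ℝ), 0 < ν → 0 < T →
      ∀ (u : ℝ → EuclideanSpace ℝ (Fin 3) → EuclideanSpace ℝ (Fin 3))
        (p : ℝ → EuclideanSpace ℝ (Fin 3) → ℝ),
        Literature.Analysis.FluidPDE.IsClassicalNSSolutionOn (Set.Ico 0 T) ν 0 u p →
        Literature.Analysis.FluidPDE.IsLerayHopfOn T ν 0 (u 0) u →
        Literature.Analysis.FluidPDE.HasRapidSpatialDecay (u 0) →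
        ∀ x : EuclideanSpace ℝ (Fin 3), ¬ IsBackwardSingularPoint u (T, x)) →
    Summit.NavierStokesRegularity.NavierStokesRegularity.Theses.HodographBetchov.FastClassSqueeze := by
  intro H ν T hν hT u p hcl hLH hdec
  exact conclusion_of_forall_not_isBackwardSingularPoint hν hT hcl hLH hdec (H ν T hν hT u p hcl hLH hdec)

/-- **`FastClassSqueeze` from the germ squeeze** (localisation of the crux to germs at the top
singular set).  Suppose that along every flow of the crux there are an open `U ⊇ Σ_T(u)`, a time
`τ < T`, a level `l`, an exponent `q > 3/2` and a nonnegative min–max middle-strain majorant `m`,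
demanded only at fast points of `(τ,T) × U`, with `∫_τ^T (∫_{{l<|u(t)|} ∩ U} m^q)^{2/(2q−3)} < ∞`.
Then `FastClassSqueeze` holds (`conclusion_of_germSqueeze`).  The converse is trivial (`U = ℝ³`), so
the crux is exactly a statement about germs of the flow at `{T} × Σ_T(u)` — a compact set of the
final slice (`isCompact_topSingularSet`), `ℋ¹`-null by the companion file.
[cite: Tao2011, Cor. 11.1 + Cor. 4.3 + Thm. 5.4 (iv)] -/
theorem fastClassSqueeze_of_germSqueeze :
    (∀ (ν T : ℝ), 0 < ν → 0 < T →
      ∀ (u : ℝ → EuclideanSpace ℝ (Fin 3) → EuclideanSpace ℝ (Fin 3))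
        (p : ℝ → EuclideanSpace ℝ (Fin 3) → ℝ),
        Literature.Analysis.FluidPDE.IsClassicalNSSolutionOn (Set.Ico 0 T) ν 0 u p →
        Literature.Analysis.FluidPDE.IsLerayHopfOn T ν 0 (u 0) u →
        Literature.Analysis.FluidPDE.HasRapidSpatialDecay (u 0) →
        ∃ U : Set (EuclideanSpace ℝ (Fin 3)), IsOpen U ∧
          {x : EuclideanSpace ℝ (Fin 3) |
            Literature.Analysis.FluidPDE.IsBackwardSingularPoint u (T, x)} ⊆ U ∧
          ∃ τ : ℝ, τ < T ∧ ∃ l q : ℝ, 3 / 2 < q ∧ ∃ m : ℝ → EuclideanSpace ℝ (Fin 3) → ℝ,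
            (∀ t x, 0 ≤ m t x) ∧
            (∀ t ∈ Set.Ico 0 T, τ < t → ∀ x ∈ U, l < ‖u t x‖ →
              ∃ v w : EuclideanSpace ℝ (Fin 3), ‖v‖ = 1 ∧ ‖w‖ = 1 ∧ inner ℝ v w = 0 ∧
                ∀ α β : ℝ, inner ℝ (fderiv ℝ (u t) x (α • v + β • w)) (α • v + β • w) ≤
                  m t x * (α ^ 2 + β ^ 2)) ∧
            ∫⁻ t in Set.Ioo τ T, (∫⁻ x in {x : EuclideanSpace ℝ (Fin 3) | l < ‖u t x‖} ∩ U,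
              ENNReal.ofReal (m t x) ^ q) ^ (2 / (2 * q - 3)) < ⊤) →
    Summit.NavierStokesRegularity.NavierStokesRegularity.Theses.HodographBetchov.FastClassSqueeze := by
  intro H ν T hν hT u p hcl hLH hdec
  obtain ⟨U, hU, hSU, τ, hτT, l, q, hq, m, hm0, hclause, hint⟩ := H ν T hν hT u p hcl hLH hdec
  exact conclusion_of_germSqueeze hν hT hcl hLH hdec hU hSU hτT hq hm0 hclause hint

end Summit.NavierStokesRegularity.NavierStokesRegularity.Theorems.FastClassSqueeze.Germ

end
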